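import Mathlib
import HarnessLib
import HarnessLib.Audit
import Summits.HubbardSuperconductivity.Statement
import Literature.MathematicalPhysics.QuantumLattice.KohnLuttinger
import Literature.MathematicalPhysics.QuantumLattice.DWaveSource
import Summits.HubbardSuperconductivity.HubbardSuperconductivity.Theorems.ThermalWedgeAssemblyStructural
import HarnessLib.Audit.Status.Attr

/-!
Route: ThermalWedge

DORMANT since 2026-08-24T07:12:05Z (reconciler: no traction for 6.6 d (last activity item-evidence-added at 2026-08-17T16:49:27Z); parked, not closed — `ledger route dormant route-HubbardSuperconductivity-ThermalWedge --off` to reactiva) — unstaffed, not closed; items shared with open routes are served there. `ledger route dormant <id> --off` reactivates.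

Route ThermalWedge — realises idea card
HubbardSuperconductivity/HubbardSuperconductivity/thermal-wedge-entropy-sandwich
("0 <= e_L - f_L(beta) <= T ln4 turns proved T>0 Fermi-liquid technology into T=0 facts").

THESIS X (it suffices to show) = SEEDED ANCHOR ∧ TIP, for the number-conserving family
H_L(U,g) := hubbardTorus 2 L 1 U - (g/L^2)·P_L,  P_L := (pairField dWaveFormFactor L)ᴴ(pairField
dWaveFormFactor L) (= 2Δ_d†Δ_d),
in the summit's own sector V_L = szSector N_L 0, N_L = 2⌊(1-δ)L²/2⌋:
 (ANCHOR, TwSeededRung) for every δ ∈ [1/10,2/5] there are U₀, K > 0 (K·U₀ ≤ 1/20) such that for all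
0 < U ≤ U₀ and
   EVERY seed g ∈ [K·U, 1/10], every normalised (N_L,S^z=0)-sector ground state of H_L(U,g) has
⟨ψ,P_Lψ⟩ ≥ c(U,g)·L⁴ along
   large even L — every-ground-state d-wave LRO of the seeded repulsive model down to seeds
COMPARABLE WITH THE BARE U;
 (TIP, TwTipContinuation) for some δ in that window and all small U, such seeded order down to g =
K·U forces the summit's
   conclusion for hubbardTorus 2 L 1 U = H_L(U,0) (the bet: no transition as the B1g seed is
switched off at weak coupling).
Assembly (pure logic, rc0 in the planner's Sketch.lean incl. a proof): TwSeededRung →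
TwTipContinuation → HubbardSuperconductivity.
One-line Lean form of X: `TwSeededRung ∧ TwTipContinuation` (decls of this file; every constant
exists today:
Literature.MathematicalPhysics.QuantumLattice.{hubbardTorus, hubbardTorusWith, dWaveSourceTorus,
pairField, dWaveFormFactor,
szSector, IsGroundStateInSector, expect, Fock, Orb, FermionTorus, torusPullback, pairFieldCorr},
Matrix.minEnergyOn, Matrix.partitionFn,
Literature.Probability.LatticeModels.{HasLongRangeOrder, halfOpenBox}; all 12 decls elaborate, lean
check rc 0).

THE ENGINE (why the anchor is reachable with WRITTEN technology — the card's mechanism). Three exact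
finite-L facts:
(i) variational chords: every GS ψ of H_L(U,g) has ⟨P_L⟩_ψ ≥ L⁴(e(g')-e(g))/(g-g') for g' < g, and
every GS of H_L(U,0) has
g₁⟨P_L⟩_ψ ≤ L⁴(e(0)-e(g₁)), e(g) = minEnergyOn/L² (one line each, no Danskin needed);
(ii) ENTROPY SANDWICH f ≤ e ≤ f + T·L⁻² log dim V ≤ f + T ln4 (from e^{-βE₀} ≤ Tr_V e^{-βH} ≤ dim
V·e^{-βE₀});
(iii) Legendre/ensemble bookkeeping e ≥ μN/L² − p_L(β,μ,g) for every μ (trivial half;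
TwSectorEnergyLowerBound) and its converse at
the canonical chemical potential (TwPureThermalBound for the pure model = standard;
TwSeededEnsembleEquivalence for the seeded
mean-field model = crux). Hence GROUND-STATE d-wave order of the pure model is bounded ABOVE, and of
the seeded model BELOW, by
the seed response of a POSITIVE-TEMPERATURE grand-canonical pressure plus the entropy price T ln4 —
and T > 0 is where control
exists: the approximating-Hamiltonian theorem p_L(β,μ,g) − sup_h[p̃_L(β,μ,h) − h²/g] → 0 for the
torus pressure with the linear
pair source h (Bogoliubov Jr.–Brankov–Zagrebnov–Kurbatov–Tonchev 1984; Bru–de Siqueira Pedra Mem.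
AMS 224 (2013), incl. periodic
b.c.; typed as support TwApproximatingHamiltonian), and the Benfatto–Giuliani–Mastropietro
convergent expansion for T ≥ W e^{-a/U}
(AHP 7 (2006) Thm 1.1, proved at low density; its extension to the summit's fillings WITH a Nambu
pair source is the rank-2 crux
TwSourcedInertness (finite pair susceptibility χ_d ≲ C(1+log β)) and crux TwSourcedCondensation
(Cooper log with the favourable
sign: p̃(h) − p̃(0) ≥ c h² log(1/(|h|+T)) − C h²)). At T_U = W e^{-a/U} the wedge closes for seeds g
≳ U/(a ρ_d):
  rung:    min-GS LRO(g) ≥ [condensation free energy Φ(T_U,g) − T_U ln4]/(g − g') > 0   (TwRungGlue,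
provable now from the 5 inputs),
  ceiling: max-GS LRO(0) ≤ ln4·T_U/g₁ = C·e^{-a/U}/U on the PURE model         (TwCeilingGlue →
TwExponentialCeiling, calibration:
           certificate routes GSCertificate/PlaquetteBoson/PairBosonDome have margin ≤ e^{-a/U}/U at
weak U).

Rationale: WHY THIS LINE. Rigorous control of the weakly repulsive 2D Hubbard model exists ONLY at positive
temperature, above the
Cooper scale: BenfattoGiulianiMastropietro2006 Thm 1.1 (arXiv:cond-mat/0507686: T ≥ e^{-a/|U|}, low
density; p.4 Rem.2: extension
to all fillings below half filling "not unlikely", U₀(μ)→0 at half filling),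
doi:10.1007/s00023-003-0125-9 (symmetric Fermi
surfaces), Disertori–Rivasseau doi:10.1007/s002200000301 (jellium). The summit is a T=0,
every-ground-state, fixed-sector statement.
The thermal wedge is the dictionary between the two: the entropy density ln4 of the EMPTY theory is
the exchange rate
(0 ≤ e_L − f_L(β) ≤ T ln4, exact at finite L), so ABSENCE of pair response of the T>0 Fermi liquid
caps T=0 order (ceiling) and
PRESENCE of condensation in the mean-field-seeded model at T>0 (approximating-Hamiltonian theorem,
Bogoliubov Jr. et al.
doi:10.1070/rm1984v039n06abeh003180; Bru–de Siqueira Pedra doi:10.1090/s0065-9266-2012-00666-6, Ch.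
on periodic b.c.) gives
every-GS T=0 order of the seeded model (rungs). Imported areas: constructive fermionic RG at T>0
(mathematical physics), convex /
Legendre duality and ensemble equivalence (statistical mechanics), approximating-Hamiltonian method
(Bogoliubov school).
Catalogue: explicit dictionary (seed g ↔ source h = g·c; canonical sector ↔ GC pressure via
one-point Legendre), monotone quantity
(concavity of g ↦ e(g)); no certified computation needed.
RANKED CRUXES (5; the anchor's typed inputs are filed now so provers can start on the engine):
 2 TwSourcedInertness — FIRST crux = the unproved T>0 input: two-point-free statement "p̃_L(β,μ,U,h)
− p̃_L(β,μ,U,0) ≤ C(1+log β)h²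
   for 1 ≤ β ≤ e^{a/U}, μ in any compact sub-interval of (−4,0)". BGM's expansion WITH a Nambu pair
source, at the summit's fillings
   (umklapp with ≤ 4 quasi-particles is what BGM could not control at μ_BGM ≥ (2−√2)/2, p.3). Alone
it yields the ceiling.
 3 TwSourcedCondensation — the matching lower bound (Cooper logarithm, favourable sign, source as
second infrared cutoff |h| ≫ T).
 4 TwSeededEnsembleEquivalence — canonical (N_L,S^z=0) free energy of the SEEDED model ≤ one-point
Legendre of its GC pressure + T ln4:
   load-bearing for rungs (linearisation fails inside a fixed-N sector: P_V Δ P_V = 0); ensemble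
inequivalence is a real
   phenomenon for long-range systems (Barré–Mukamel–Ruffo doi:10.1007/3-540-45835-2_3;
Campa–Dauxois–Ruffo doi:10.1016/j.physrep.2009.07.001).
 5 TwSeededRung — the ANCHOR (closes by TwRungGlue from 2,3,4 + two supports); first every-GS d-wave
LRO theorem with t=1 AND U>0.
 6 TwTipContinuation — the BET (∃ δ ∈ [1/10,2/5], ∃ U₁: rungs down to K·U ⇒ summit at (U,δ) for U ≤
U₁); true iff the weak-coupling
   ground state in the window is the d_{x²−y²} superconductor (RaghuKivelsonScalapino2010 Fig.2: B1g
leading for 0.6 < n < 1 at t'=0).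
SUPPORT (rank 9): TwSectorEnergyLowerBound (provable now), TwPureThermalBound (standard ensemble
equivalence + elementary μ-localisation
p₀(μ−U/2) ≤ p_U(μ) ≤ p₀(μ)), TwApproximatingHamiltonian (known theorem; port), TwCeilingGlue and
TwRungGlue (provable now: chords +
bookkeeping, constants worked out in planner NOTES), TwExponentialCeiling (target-type: limsup
max-GS L⁻⁴⟨P⟩ ≤ C e^{-a/U}/U).
KILL CRITERIA. (a) TwSourcedInertness refuted at some μ-interval ⊂ (−4,0) (pair susceptibility of
the T ≥ e^{-a/U} state not
O(log β), e.g. a competing log² from van Hove/umklapp at the needed fillings) → ceiling and rungs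
die together: close. (b)
TwSeededEnsembleEquivalence refuted (canonical sector free energy of H − gL⁻²P strictly above the
Legendre transform) → rungs die,
ceiling survives as a NoGo/GSCertificate calibration item: close route, keep
TwCeilingGlue/TwExponentialCeiling wanted. (c) A
theorem that the weak-coupling GS at every δ ∈ [1/10,2/5] is not d_{x²−y²} (other KL channel /
stripes) → Tip dead: close.
(d) ED sanity (4×4): e_L(g), f_L(β,g) exactly; the wedge inequalities are theorems — a violation
means a typing error: restate.
NOT DECOMPOSED YET (deliberately): the multiscale expansion inside cruxes 2–3 (sectors, Nambu
propagator with two IR cutoffs, nodal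
regime |h| ≫ T), the proof strategy for crux 4 (number projection of sourced Gibbs states vs.
log-concavity of Z_N), any mechanism for
the Tip (hand-over point to WeakCouplingBCS #4 / bcs-deformation-ladder), other channels (s, d_xy:
same wedge, regional ceilings).
RELATION TO OTHER LINES: same family as card bcs-deformation-ladder (T=0 nodal engine, g = O(t)) —
engines differ, only the tip is
shared; WeakCouplingBCS breaks U(1) (h→0⁺ after L→∞, SSB-transfer crux) — here N is conserved at T=0
and 'every GS' is a chord.

Novelty: Searched (this session): lit read arXiv:cond-mat/0507686 pp.3–4 (BGM Thm 1.1 hypotheses: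
0<μ_BGM<(2−√2)/2 because of
strong convexity + umklapp with n ≤ 4 quasi-particles; Remark 2: extension to all μ<2 expected with
U₀(μ)→0); lit read arXiv:1902.08047
= doi:10.1090/s0065-9266-2012-00666-6 (Bru–de Siqueira Pedra Memoirs: pressure as variational
problem for short-range + long-range
lattice fermions, chapter on periodic boundary conditions, and their §'approximating Hamiltonian
method' restating the finite-volume
theorem of Bogoliubov Jr.–Brankov–Zagrebnov–Kurbatov–Tonchev doi:10.1070/rm1984v039n06abeh003180
under conditions (A1)–(A3), which
hubbardTorusWith − gL⁻²(pairField)ᴴpairField satisfies); crossref: doi:10.1007/s00023-003-0125-9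
(BGM 2003 symmetric Fermi surfaces),
doi:10.1007/3-540-45835-2_3 and doi:10.1016/j.physrep.2009.07.001 (ensemble inequivalence for
long-range systems); lit frontier
HubbardSuperconductivity --since 2020 and lit bridges --cross any (no work joining T>0 constructive
Fermi-liquid theory to T=0 order
bounds); lit search --hybrid / galaxy --star all "approximating Hamiltonian method" (2 unrelated pdf
hits); the barrier file
Literature.Barriers.HubbardSuperconductivity.WeakCouplingCeiling (records BGM's domain, draws no T=0
consequence); all 8 route files of
the sub and the cards bcs-deformation-ladder, probe-legendre-order-ceiling, concavity-normal-form
(retired), kac-window-penalty-sandwich.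
OpenAlex/S2 daily budget exhausted (HTTP 429) — remote dis  [refs: 10.1090/s0065-9266-2012-00666-6, 10.1070/rm1984v039n06abeh003180, 10.1007/s00023-003-0125-9, 10.1007/3-540-45835-2_3, 10.1016/j.physrep.2009.07.001, cond-mat/0507686, 1902.08047, doi:10.1090/s0065-9266-2012-00666-6, doi:10.1070/rm1984v039n06abeh003180, doi:10.1007/s00023-003-0125-9, doi:10.1007/3-540-45835-2_3, doi:10.1016/j.physrep.2009.07.001, BenfattoGiulianiMastropietro2006, KomaTasaki1994]

Barriers (technique_class: positive-temperature-methods constructive-RG convexity): Literature.Barriers.HubbardSuperconductivity.WeakCouplingCeiling: USED AS THE ENGINE, not evaded —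
every T>0 input lives on the proved side β ≤ e^{a/U} (cruxes
TwSourcedInertness/TwSourcedCondensation quantify exactly 1 ≤ β ≤ exp(a/U)); the Cooper logarithm
enters twice with the right signs (χ_d ≲ C(1+log β) = inertness for seeds g < U/(Ca); p̃(h)−p̃(0) ≥
c h² log(1/(|h|+T)) = condensation for seeds g ≳ U/(ca)); nothing is claimed below the ceiling
temperature; the open tip g < K·U (TwTipContinuation) is the barrier restated quantitatively and is
declared as the bet. Scope caveat used honestly: BGM Thm 1.1 is proved only at density < 1/4; the
summit's fillings are crux #2's why-might-fail (arXiv:cond-mat/0507686 p.3 umklapp, p.4 Rem.2).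
Literature.Barriers.HubbardSuperconductivity.PositiveTemperatureNoPairLRO: EVADED BY CONSTRUCTION —
no thermal correlation function of any model is asserted to have LRO; the only T>0 objects are torus
PRESSURES (Matrix.partitionFn of hubbardTorusWith − gL⁻²P and of dWaveSourceTorus). For the pure
short-range model the T>0 input is ABSENCE of pair response (inertness), consistent with
Koma–Tasaki; the transfer to T=0 is the exact inequality 0 ≤ e_L − f_L(β) ≤ T·L⁻² log dim V, not a
limit T→0 of an ordered Gibbs state. The seeded model's T>0 condensation free energy is legitimate
because its attraction −gL⁻²P is mean-field (infinite range), outside the density–density class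
V({n_xσ}) of koma_tasaki_2d (Bru–de Siqueira Pedra 2013 Thm 'ODLRO' for

History (route lifecycle, newest last):
- 2026-08-15T22:48:57Z · rev 2: restated Assembly (stmt-HubbardSuperconductivity-1707 proved) — route-repair (glue-native-fail) rev 2: the deciding theorem was never wrong (glue.native ok=true 16:16Z) — the route stopped MATERIALISING at 22:26Z because stm (planner-rglue-HubbardSuperconductivity-Therma-aae78db9-0)
- 2026-08-16T15:32:39Z · rev 5: dropped TwKLCanonical — route-repair (cone) step 1/2 — free one of the 15 item slots for the cone-hygiene glue item TwThermalWindowRungGlue (step 2 adds it, restates `closes` over it a (planner-rrepair-HubbardSuperconductivity-Therm-aae78db9-0)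
- 2026-08-16T15:38:36Z · rev 7: restated TwThermalWindowRungGlue (stmt-HubbardSuperconductivity-15392) — route-repair (cone) step 2b-i — restate the blocked binder item TwThermalWindowRungGlue (stmt-15392 rendered `BLOCKED: missing decl TwSeededRung` because the ga (planner-rrepair-HubbardSuperconductivity-Therm-aae78db9-0)
- 2026-08-16T15:48:43Z · rev 9: dropped TwCertB1gWedge — route-repair (unused-crux) rev 9: DROP TwCertB1gWedge (stmt-HubbardSuperconductivity-15257). It is not load-bearing for `closes` (hypotheses hC hE hG hT unchang (planner-rrepair-HubbardSuperconductivity-Therm-d8dac303-0)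
- 2026-08-24T07:12:05Z · DORMANT — reconciler: no traction for 6.6 d (last activity item-evidence-added at 2026-08-17T16:49:27Z); parked, not closed — `ledger route dormant route-HubbardSupercond (operator:999:4112810)

sub-problem: HubbardSuperconductivity · status: dormant · opened planner-plancard-HubbardSuperconductivity-Hub-01234c3f-0 2026-08-15T10:58:08Z · rev 9 · ledger route-HubbardSuperconductivity-ThermalWedge
GENERATED by the gate from the ledger (D-0016/17). Provers cite these decls: `theorem foo : Summit.HubbardSuperconductivity.HubbardSuperconductivity.Theses.ThermalWedge.<Decl> := …` in Summits/HubbardSuperconductivity/HubbardSuperconductivity/Theorems/<Name>.lean.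
-/

namespace Summit.HubbardSuperconductivity.HubbardSuperconductivity.Theses.ThermalWedge

open scoped BigOperators Topology Manifold Classical MeasureTheory ProbabilityTheory Matrix InnerProductSpace ComplexConjugate ContinuousMap
open Filter Set Function TopologicalSpace MeasureTheory

attribute [summit_statement] _root_.HubbardSuperconductivity

open Literature.Hubbard

/-- item stmt-HubbardSuperconductivity-1696 · crux · rank 2 · open · by planner
why it might fail: Convergent RG for the t=1 Hubbard torus at T≥e^{-a/U} is in print only for μ_BGM<(2−√2)/2, density ≲0.1 (cond-mat/0507686 Thm 1.1; p.3: umklapp with ≤4 quasi-particles); at densities 0.6–0.9 the counterterm inversion is unsolved (cond-mat/0207210 p.5) and the h-uniform sourced expansion unwritten.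
sources: BenfattoGiulianiMastropietro2006, arXiv:cond-mat/0507686, BenfattoGiulianiMastropietro2003, arXiv:cond-mat/0207210, DisertoriRivasseau2000, Salmhofer1999
[crux] SEED-INERTNESS OF THE SOURCED FERMI LIQUID (the route's FIRST crux = the one unproved T>0
input; card thermal-wedge-entropy-sandwich item (4)). NOTATION (all items): P_L := (pairField
dWaveFormFactor L)ᴴ(pairField dWaveFormFactor L) (= 2Δ_d†Δ_d); seeded Hamiltonians H_L(U,g) :=
hubbardTorus 2 L 1 U − (g/L²)P_L (canonical) and hubbardTorusWith 2 L 1 U μ − (g/L²)P_L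
(grand-canonical); V := szSector N 0; e(g) := minEnergyOn(H_L(U,g), V)/L²; p_L(β,μ,U,g) := log
Z/(βL²) of the GC seeded model (Matrix.partitionFn); p̃_L(β,μ,U,h) := the same for dWaveSourceTorus
L U μ h = hubbardTorusWith − h(pairField + pairFieldᴴ) (linear, U(1)-breaking pair SOURCE, h real;
p̃ is even in h by a gauge rotation). CLAIM: for every compact [μ₁,μ₂] ⊂ (−4,0) (all fillings
strictly between empty and half-filled, t=1 band [−4,4]) there are U₀,a,C>0 such that for 0<U≤U₀,
1≤β≤e^{a/U}, μ∈[μ₁,μ₂], eventually in L and for ALL real h: p̃_L(β,μ,U,h) − p̃_L(β,μ,U,0) ≤ C(1+log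
β)h². Meaning: the torus Gibbs state at T ≥ W e^{−a/U} has d-wave pair susceptibility (incl. its
nonlinear regime |h| ≲ 1/(C log β)) of Fermi-liquid size χ_d ≲ ρ_d log(βW); for |h| ≥ 8√2/(C(1+log
β)) the bound is automatic (p̃ convex, 8√2-L -/
@[route_item "route-HubbardSuperconductivity-ThermalWedge", crux]
def TwSourcedInertness : Prop :=
  ∀ μ₁ μ₂ : ℝ, -4 < μ₁ → μ₁ ≤ μ₂ → μ₂ < 0 → ∃ U₀ a C : ℝ, 0 < U₀ ∧ 0 < a ∧ 0 < C ∧ ∀ U : ℝ, 0 < U → U ≤ U₀ → ∀ β : ℝ, 1 ≤ β → β ≤ Real.exp (a / U) → ∀ μ ∈ Set.Icc μ₁ μ₂, ∃ L₀ : ℕ, ∀ (L : ℕ) [NeZero L], L₀ ≤ L → ∀ h : ℝ, (Real.log (Matrix.partitionFn β (Literature.MathematicalPhysics.QuantumLattice.dWaveSourceTorus L U μ h)).re / (β * (L : ℝ) ^ 2)) - (Real.log (Matrix.partitionFn β (Literature.MathematicalPhysics.QuantumLattice.dWaveSourceTorus L U μ 0)).re / (β * (L : ℝ) ^ 2)) ≤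 C * (1 + Real.log β) * h ^ 2

/-- item stmt-HubbardSuperconductivity-1697 · crux · rank 3 · open · by planner
why it might fail: Same unwritten sourced expansion at densities 0.6–0.9, now for T≪|h|≤h₀ with the (nodally gapless) source as infrared cutoff; no cheap route: a Gibbs-variational comparison leaves an h-independent O(U²) pressure shift that swamps c·h²·log(1/|h|) for |h|≪U, so 2nd-order control of p̃(0) is needed.
sources: BenfattoGiulianiMastropietro2006, BenfattoGiulianiMastropietro2003, arXiv:cond-mat/0207210, Mastropietro2008, Salmhofer1999, Literature.Barriers.HubbardSuperconductivity.WeakCouplingCeiling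
[crux] CONDENSATION LOWER BOUND OF THE SOURCED PRESSURE (Cooper logarithm with the favourable sign;
second constructive input, needed by the rungs only). NOTATION (all items): P_L := (pairField
dWaveFormFactor L)ᴴ(pairField dWaveFormFactor L) (= 2Δ_d†Δ_d); seeded Hamiltonians H_L(U,g) :=
hubbardTorus 2 L 1 U − (g/L²)P_L (canonical) and hubbardTorusWith 2 L 1 U μ − (g/L²)P_L
(grand-canonical); V := szSector N 0; e(g) := minEnergyOn(H_L(U,g), V)/L²; p_L(β,μ,U,g) := log
Z/(βL²) of the GC seeded model (Matrix.partitionFn); p̃_L(β,μ,U,h) := the same for dWaveSourceTorus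
L U μ h = hubbardTorusWith − h(pairField + pairFieldᴴ) (linear, U(1)-breaking pair SOURCE, h real;
p̃ is even in h by a gauge rotation). CLAIM: for every compact [μ₁,μ₂] ⊂ (−4,0) there are
U₀,a,c,C,h₀>0 such that for 0<U≤U₀, 1≤β≤e^{a/U}, μ∈[μ₁,μ₂], eventually in L, for |h| ≤ h₀: p̃_L(h) −
p̃_L(0) ≥ c h² log(1/(|h|+1/β)) − C h². For the FREE gas this is an identity-level computation:
p̃₀(h)−p̃₀(0) = (2/βL²)Σ_k[log cosh(βE_k/2) − log cosh(βξ_k/2)], E_k = √(ξ_k²+4h²φ_k²), and log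
cosh(βE/2) − log cosh(βξ/2) ≥ (E²−ξ²)·β tanh(βE/2)/(4E) gives ≥ 2h² L⁻²Σ_k φ_k² tanh(βE_k/2)/E_k ≈
2ρ_d h² log(W/max(T,|h|)) (the Cooper logarithm -/
@[route_item "route-HubbardSuperconductivity-ThermalWedge", crux]
def TwSourcedCondensation : Prop :=
  ∀ μ₁ μ₂ : ℝ, -4 < μ₁ → μ₁ ≤ μ₂ → μ₂ < 0 → ∃ U₀ a c C h₀ : ℝ, 0 < U₀ ∧ 0 < a ∧ 0 < c ∧ 0 < C ∧ 0 < h₀ ∧ ∀ U : ℝ, 0 < U → U ≤ U₀ → ∀ β : ℝ, 1 ≤ β → β ≤ Real.exp (a / U) → ∀ μ ∈ Set.Icc μ₁ μ₂, ∃ L₀ : ℕ, ∀ (L : ℕ) [NeZero L], L₀ ≤ L → ∀ h : ℝ, |h| ≤ h₀ → c * h ^ 2 * Real.log (1 / (|h| + 1 / β)) - C * h ^ 2 ≤ (Real.log (Matrix.partitionFn β (Literature.MathematicalPhysics.QuantumLattice.dWaveSourceTorus L U μ h)).re / (β * (L : ℝ) ^ 2)) - (Real.log (Matrix.partitionFn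 β (Literature.MathematicalPhysics.QuantumLattice.dWaveSourceTorus L U μ 0)).re / (β * (L : ℝ) ^ 2))

/-- item stmt-HubbardSuperconductivity-15581 · crux · rank 4 · open · by planner
why it might fail: Even on one thermal window (β≤e^{a/U}, g≥K'U) the defect bound = no first-order density jump of the d-wave-seeded torus at n=1−δ uniformly as U→0⁺: needs the sourced expansion one μ-derivative deeper than BGM2006 (fillings 0.6–0.9 unwritten) + unique optimal source modulus.
sources: BruPedra2013, BogolyubovJrEtAl1984, BenfattoGiulianiMastropietro2006, arXiv:cond-mat/0507686, RaggioWerner1989, Ruelle1969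
[crux] REPAIRED TwSeededEnsembleEquivalence (route-repair g3, 2026-08-16): the THERMAL-WINDOW
canonical/grand-canonical defect bound of the d-wave-SEEDED model. Notation of the other items (P_L,
H_L(U,g), e(g), p_L). CLAIM: for δ ∈ [1/10,2/5] there are −4<μ₁≤μ₂<0 and a, K', U₀ > 0 such that for
0<U≤U₀, every seed g ∈ [K'·U, 1/10] and every 1 ≤ β ≤ e^{a/U} some μ ∈ [μ₁,μ₂] has e(g) +
p_L(β,μ,U,g) − μN_L/L² ≤ ln4/β + ε eventually in L (N_L = 2⌊(1−δ)L²/2⌋). It is VERBATIM the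
hypothesis `hEns` of the landed route-file-free engine
Theorems.twSeededRung_structural_thermalWindow (ThermalWedgeTwSeededRungThermalWindow.lean, p97295):
THIS ITEM + TwSourcedCondensation ⟹ TwSeededRung (common exponent a := min aᵉ aᶜ, probe source s =
e^{−a/(4U)}, K := max(16/(ca), K')), which is how the deciding theorem `closes` now discharges the
anchor. WHY A NEW ITEM: stmt-HubbardSuperconductivity-1698 as filed (∀β ≥ 1, ∀g ∈ (0,1/10]) is
kernel-equivalent to the β-free T=0 hull touch HullTouchT0Strong
(Theorems/TwSeededEnsembleEquivalence/Negative/HullTouchNormalForm; line lead c1 `verdict: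
misstated` 2026-08-16, disprover gens 1–4, triage r1-1..3 and leads gen0–c2 concur): the T=0 phase
diagram of the wea -/
@[route_item "route-HubbardSuperconductivity-ThermalWedge", crux]
def TwSeededEnsembleEquivalenceR : Prop :=
  ∀ δ ∈ Set.Icc (1/10 : ℝ) (2/5 : ℝ), ∃ μ₁ μ₂ : ℝ, -4 < μ₁ ∧ μ₁ ≤ μ₂ ∧ μ₂ < 0 ∧ ∃ a K' U₀ : ℝ, 0 < a ∧ 0 < K' ∧ 0 < U₀ ∧ ∀ U ∈ Set.Ioc (0 : ℝ) U₀, ∀ g ∈ Set.Icc (K' * U) (1 / 10), ∀ β : ℝ, 1 ≤ β → β ≤ Real.exp (a / U) → ∃ μ ∈ Set.Icc μ₁ μ₂, ∀ ε : ℝ, 0 < ε → ∃ L₀ : ℕ, ∀ (L : ℕ) [NeZero L], L₀ ≤ L → (((Literature.MathematicalPhysics.QuantumLattice.hubbardTorus 2 L 1 U - ((g / (L : ℝ) ^ 2 : ℝ) : ℂ) • ((Literature.MathematicalPhysics.QuantumLattice.pairField Literature.MathematicalPhysics.QuantumLattice.dWaveFormFactor L)ᴴ * Literature.MathematicalPhysics.QuantumLattice.pairField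 Literature.MathematicalPhysics.QuantumLattice.dWaveFormFactor L))).minEnergyOn (Literature.MathematicalPhysics.QuantumLattice.szSector (Λ := Literature.MathematicalPhysics.QuantumLattice.FermionTorus 2 L) (2 * ⌊(1 - δ) * (L : ℝ) ^ 2 / 2⌋₊) 0) / (L : ℝ) ^ 2) + (Real.log (Matrix.partitionFn β (Literature.MathematicalPhysics.QuantumLattice.hubbardTorusWith 2 L 1 U μ - ((g / (L : ℝ) ^ 2 : ℝ) : ℂ) • ((Literature.MathematicalPhysics.QuantumLattice.pairField Literature.MathematicalPhysics.QuantumLattice.dWaveFormFactor L)ᴴ * Literature.MathematicalPhysics.QuantumLattice.pairField Literature.MathematicalPhysics.QuantumLattice.dWaveFormFactor L))).re / (β * (L : ℝ) ^ 2)) - μ * ((2 * ⌊(1 - δ) * (L : ℝ) ^ 2 / 2⌋₊) : ℝ) / (L : ℝ) ^ 2 ≤ Real.log 4 / β + ε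

/-- item stmt-HubbardSuperconductivity-1698 · crux · rank 4 · open · by planner
why it might fail: Canonical=Legendre(GC) at n=1−δ needs log-concavity of N↦Z_N for H_U−gL⁻²Δ†Δ uniformly in β≥1; two-box subadditivity fails for the mean-field term (fixed-N products see only g/2 since P_VΔP_V=0), only the GC pressure is in print (AHM; Bru–Pedra), and a density jump in μ would make it false.
sources: BruPedra2013, BogolyubovJrEtAl1984, RaggioWerner1989, Ruelle1969, Griffiths1966, doi:10.1016/j.physrep.2009.07.001
[crux] CANONICAL/GRAND-CANONICAL EQUIVALENCE FOR THE SEEDED (MEAN-FIELD) MODEL + ENTROPY PRICE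
(load-bearing for the rungs; card item (2) 'OnePointLegendre', sharpened). NOTATION (all items): P_L
:= (pairField dWaveFormFactor L)ᴴ(pairField dWaveFormFactor L) (= 2Δ_d†Δ_d); seeded Hamiltonians
H_L(U,g) := hubbardTorus 2 L 1 U − (g/L²)P_L (canonical) and hubbardTorusWith 2 L 1 U μ − (g/L²)P_L
(grand-canonical); V := szSector N 0; e(g) := minEnergyOn(H_L(U,g), V)/L²; p_L(β,μ,U,g) := log
Z/(βL²) of the GC seeded model (Matrix.partitionFn); p̃_L(β,μ,U,h) := the same for dWaveSourceTorus
L U μ h = hubbardTorusWith − h(pairField + pairFieldᴴ) (linear, U(1)-breaking pair SOURCE, h real;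
p̃ is even in h by a gauge rotation). CLAIM: for δ ∈ [1/10,2/5] there are −4<μ₁≤μ₂<0 and U₀>0 such
that for 0<U≤U₀, every seed g ∈ (0,1/10] and every β ≥ 1 there is μ ∈ [μ₁,μ₂] with e(g) +
p_L(β,μ,U,g) − μN_L/L² ≤ ln4/β + ε eventually in L (N_L = 2⌊(1−δ)L²/2⌋). CONTENT: (i) e(g) ≤
f^V_L(β,g) + (βL²)⁻¹ log dim V ≤ f^V + ln4/β (entropy sandwich, exact: Tr_V e^{−βH} ≤ dim
V·e^{−βE₀}); (ii) the canonical sector free energy f^V_L(β,g) of H_L(U,g) converges to the one-point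
Legendre transform sup_μ[μn − p(β,μ,U,g) -/
@[route_item "route-HubbardSuperconductivity-ThermalWedge", crux]
def TwSeededEnsembleEquivalence : Prop :=
  ∀ δ ∈ Set.Icc (1/10 : ℝ) (2/5 : ℝ), ∃ μ₁ μ₂ : ℝ, -4 < μ₁ ∧ μ₁ ≤ μ₂ ∧ μ₂ < 0 ∧ ∃ U₀ : ℝ, 0 < U₀ ∧ ∀ U ∈ Set.Ioc (0 : ℝ) U₀, ∀ g ∈ Set.Ioc (0 : ℝ) (1 / 10), ∀ β : ℝ, 1 ≤ β → ∃ μ ∈ Set.Icc μ₁ μ₂, ∀ ε : ℝ, 0 < ε → ∃ L₀ : ℕ, ∀ (L : ℕ) [NeZero L], L₀ ≤ L → (((Literature.MathematicalPhysics.QuantumLattice.hubbardTorus 2 L 1 U - ((g / (L : ℝ) ^ 2 : ℝ) : ℂ) • ((Literature.MathematicalPhysics.QuantumLattice.pairField Literature.MathematicalPhysics.QuantumLattice.dWaveFormFactor L)ᴴ * Literature.MathematicalPhysics.QuantumLattice.pairField Literature.MathematicalPhysics.QuantumLattice.dWaveFormFactor L))).minEnergyOn (Literature.MathematicalPhysics.QuantumLattice.szSector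 (Λ := Literature.MathematicalPhysics.QuantumLattice.FermionTorus 2 L) (2 * ⌊(1 - δ) * (L : ℝ) ^ 2 / 2⌋₊) 0) / (L : ℝ) ^ 2) + (Real.log (Matrix.partitionFn β (Literature.MathematicalPhysics.QuantumLattice.hubbardTorusWith 2 L 1 U μ - ((g / (L : ℝ) ^ 2 : ℝ) : ℂ) • ((Literature.MathematicalPhysics.QuantumLattice.pairField Literature.MathematicalPhysics.QuantumLattice.dWaveFormFactor L)ᴴ * Literature.MathematicalPhysics.QuantumLattice.pairField Literature.MathematicalPhysics.QuantumLattice.dWaveFormFactor L))).re / (β * (L : ℝ) ^ 2)) - μ * ((2 * ⌊(1 - δ) * (L : ℝ) ^ 2 / 2⌋₊) : ℝ) / (L : ℝ) ^ 2 ≤ Real.log 4 / β + ε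

-- earlier TwThermalWindowRungGlue (stmt-HubbardSuperconductivity-15392, replaced 2026-08-16T15:38:36Z -> stmt-HubbardSuperconductivity-15417): retired by None — TwSeededEnsembleEquivalenceR → TwSourcedCondensation → TwSeededRung
/-- item stmt-HubbardSuperconductivity-15417 · crux · rank 5 · closed · proved by Summit.HubbardSuperconductivity.HubbardSuperconductivity.Theorems.twThermalWindowRungGlue_proof @ 811de43451b8 (prover) · by planner
why it might fail: Essentially cannot: it is the landed kernel-checked engine twSeededRung_structural_thermalWindow (p97295) restated over route decls; fails only if TwSeededEnsembleEquivalenceR/TwSourcedCondensation/TwSeededRung get restated so their bodies drift from the engine's verbatim hypotheses (re-port).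
sources: Summit.HubbardSuperconductivity.HubbardSuperconductivity.Theorems.twSeededRung_structural_thermalWindow, p97295, idea:HubbardSuperconductivity/HubbardSuperconductivity/thermal-wedge-entropy-sandwich
[crux BY ADMISSIBILITY ONLY — support-grade GLUE, proved in substance (three-line port); re-kind to
support once closed; CONE HYGIENE, route-repair 2026-08-16] THERMAL-WINDOW RUNG GLUE:
TwSeededEnsembleEquivalenceR → TwSourcedCondensation → ⟨body of TwSeededRung, VERBATIM — inlined
because the gate renders cruxes before support items, so a crux cannot name the support decl
TwSeededRung (rev 6 rendered this item BLOCKED: missing decl)⟩, i.e. the landed route-file-free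
engine
`Summit.HubbardSuperconductivity.HubbardSuperconductivity.Theorems.twSeededRung_structural_thermalWindow`
(Theorems/ThermalWedgeTwSeededRungThermalWindow.lean, p97295; its two hypotheses and its conclusion
are the VERBATIM bodies of the three route decls) restated as an implication between route decls,
like TwRungGlue / TwCeilingGlue. PROOF (prover, ~10 lines, DO IT FIRST — it returns the whole route
to crux-only accounting): a NEW file Theorems/ThermalWedgeTwThermalWindowRungGlue.lean importing
BOTH Summits.HubbardSuperconductivity.HubbardSuperconductivity.Theses.ThermalWedge AND
Summits.HubbardSuperconductivity.HubbardSuperconductivity.Theorems.ThermalWedgeTwSeededRungThermalWindow,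
with `theorem twThermalWind -/
@[route_item "route-HubbardSuperconductivity-ThermalWedge", crux]
def TwThermalWindowRungGlue : Prop :=
  TwSeededEnsembleEquivalenceR → TwSourcedCondensation → ∀ δ ∈ Set.Icc (1/10 : ℝ) (2/5 : ℝ), ∃ U₀ K : ℝ, 0 < U₀ ∧ 0 < K ∧ K * U₀ ≤ 1 / 20 ∧ ∀ U ∈ Set.Ioc (0 : ℝ) U₀, (∀ g ∈ Set.Icc (K * U) (1 / 10), ∃ c : ℝ, 0 < c ∧ ∃ L₀ : ℕ, ∀ (L : ℕ) [NeZero L], L₀ ≤ L → Even L → ∀ (ψ : Literature.MathematicalPhysics.QuantumLattice.Fock (Literature.MathematicalPhysics.QuantumLattice.Orb (Literature.MathematicalPhysics.QuantumLattice.FermionTorus 2 L))), star ψ ⬝ᵥ ψ = 1 → Literature.MathematicalPhysics.QuantumLattice.IsGroundStateInSector (Literature.MathematicalPhysics.QuantumLattice.hubbardTorus 2 L 1 U - ((g / (L : ℝ) ^ 2 : ℝ) : ℂ) • ((Literature.MathematicalPhysics.QuantumLattice.pairField Literature.MathematicalPhysics.QuantumLattice.dWaveFormFactor L)ᴴ *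 Literature.MathematicalPhysics.QuantumLattice.pairField Literature.MathematicalPhysics.QuantumLattice.dWaveFormFactor L)) (2 * ⌊(1 - δ) * (L : ℝ) ^ 2 / 2⌋₊) 0 ψ → c * (L : ℝ) ^ 4 ≤ (Literature.MathematicalPhysics.QuantumLattice.expect ((Literature.MathematicalPhysics.QuantumLattice.pairField Literature.MathematicalPhysics.QuantumLattice.dWaveFormFactor L)ᴴ * Literature.MathematicalPhysics.QuantumLattice.pairField Literature.MathematicalPhysics.QuantumLattice.dWaveFormFactor L) ψ).re)

/-- item stmt-HubbardSuperconductivity-1700 · crux · rank 6 · open · by planner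
why it might fail: RUNG⇒summit has no mechanism: seeded order at g=KU is e^{-O(1/U)}, pure-model Kohn–Luttinger pairing e^{-O(1/U²)}, and g↦order must cross that gap with no transition; false if B1g is not the leading KL channel at any δ∈[0.1,0.4] (t'=0), if stripe/AF order wins as U→0, or if g=0 degeneracy breaks it.
sources: RaghuKivelsonScalapino2010, ArovasBergKivelsonRaghu2022, KomaTasaki1994, Literature.MathematicalPhysics.QuantumLattice.channelInf, Literature.Barriers.HubbardSuperconductivity.PureModelStripeCompetition, Literature.Barriers.HubbardSuperconductivity.PerturbativeInvisibilityOfPairing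
[crux] THE BET — TIP OF THE WEDGE (typed as an implication so that the Assembly is pure logic; the
summit is the g→0 corner of the seeded family). CLAIM: ∃ U₁>0 ∃ δ ∈ [1/10,2/5] such that for every
0<U≤U₁ and every K>0 with K·U ≤ 1/20: [RUNG(U,δ,K): every-GS d-wave order ⟨P_L⟩ ≥ c(g)L⁴ of H_L(U,g)
for all seeds g ∈ [K·U,1/10], even L large] ⇒ [the summit's conclusion at (U,δ): every
HYP-admissible ground-state sequence of hubbardTorus 2 L 1 U = H_L(U,0) has HasLongRangeOrder of
torusPullback (pairFieldCorr dWaveFormFactor ψ) along even sides]. CONTENT: no quantum phase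
transition as the number-conserving B1g seed is switched off from strength K·U (comparable with the
bare repulsion!) to 0 at fixed weak U, plus the every-GS/liminf bookkeeping at g=0. TRUE iff the
weak-coupling ground state at that δ is the d_{x²−y²} superconductor the Kohn–Luttinger analysis
predicts (RaghuKivelsonScalapino2010 §III Fig.2: B1g leading for 0.6<n<1 at t'=0;
ArovasBergKivelsonRaghu2022 §5.1) — then the seed only deepens the same minimum and g ↦ max-GS order
is continuous through 0; FALSE if another channel/stripe order wins at every δ in the window.
Tool-less today like every continuation (cf. PbContin -/
@[route_item "route-HubbardSuperconductivity-ThermalWedge", crux]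
def TwTipContinuation : Prop :=
  ∃ U₁ : ℝ, 0 < U₁ ∧ ∃ δ ∈ Set.Icc (1/10 : ℝ) (2/5 : ℝ), ∀ U ∈ Set.Ioc (0 : ℝ) U₁, ∀ K : ℝ, 0 < K → K * U ≤ 1 / 20 → (∀ g ∈ Set.Icc (K * U) (1 / 10), ∃ c : ℝ, 0 < c ∧ ∃ L₀ : ℕ, ∀ (L : ℕ) [NeZero L], L₀ ≤ L → Even L → ∀ (ψ : Literature.MathematicalPhysics.QuantumLattice.Fock (Literature.MathematicalPhysics.QuantumLattice.Orb (Literature.MathematicalPhysics.QuantumLattice.FermionTorus 2 L))), star ψ ⬝ᵥ ψ = 1 → Literature.MathematicalPhysics.QuantumLattice.IsGroundStateInSector (Literature.MathematicalPhysics.QuantumLattice.hubbardTorus 2 L 1 U - ((g / (L : ℝ) ^ 2 : ℝ) : ℂ) • ((Literature.MathematicalPhysics.QuantumLattice.pairField Literature.MathematicalPhysics.QuantumLattice.dWaveFormFactor L)ᴴ * Literature.MathematicalPhysics.QuantumLattice.pairField Literature.MathematicalPhysics.QuantumLattice.dWaveFormFactor L)) (2 * ⌊(1 - δ) * (L : ℝ)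 ^ 2 / 2⌋₊) 0 ψ → c * (L : ℝ) ^ 4 ≤ (Literature.MathematicalPhysics.QuantumLattice.expect ((Literature.MathematicalPhysics.QuantumLattice.pairField Literature.MathematicalPhysics.QuantumLattice.dWaveFormFactor L)ᴴ * Literature.MathematicalPhysics.QuantumLattice.pairField Literature.MathematicalPhysics.QuantumLattice.dWaveFormFactor L) ψ).re) → (∀ (N : ℕ → ℕ) (ψ : ∀ L, Literature.MathematicalPhysics.QuantumLattice.Fock (Literature.MathematicalPhysics.QuantumLattice.Orb (Literature.MathematicalPhysics.QuantumLattice.FermionTorus 2 L))), (∀ L, Even L → N L = 2 * ⌊(1 - δ) * (L : ℝ) ^ 2 / 2⌋₊ ∧ star (ψ L) ⬝ᵥ ψ L = 1 ∧ Literature.MathematicalPhysics.QuantumLattice.IsGroundStateInSector (Literature.MathematicalPhysics.QuantumLattice.hubbardTorus 2 L 1 U) (N L) 0 (ψ L)) → Literature.Probability.LatticeModels.HasLongRangeOrder (fun k => Literature.Probability.LatticeModels.halfOpenBox 2 (2 * k)) (fun k => Literature.MathematicalPhysics.QuantumLattice.torusPullback (Literature.MathematicalPhysics.QuantumLattice.pairFieldCorr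 Literature.MathematicalPhysics.QuantumLattice.dWaveFormFactor ψ) (2 * k)))

/-- item stmt-HubbardSuperconductivity-1699 · support · rank 5 · open · by planner
why it might fail: Inherits cruxes 2–4: fails if the sourced Fermi-liquid expansion cannot be made uniform at the summit's fillings, or if canonical/GC equivalence fails for the seeded model; the constant c(U,g) ~ e^{−2θa/U} is astronomically small near g = K·U (true but useless there).
sources: BenfattoGiulianiMastropietro2006, BruPedra2013, BogolyubovJrEtAl1984, KomaTasaki1994, idea:HubbardSuperconductivity/HubbardSuperconductivity/thermal-wedge-entropy-sandwich
[crux] THE ANCHOR: EVERY-GROUND-STATE d-WAVE LRO OF THE SEEDED REPULSIVE MODEL DOWN TO SEEDS g = K·U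
(card item (B) 'rungs'). NOTATION (all items): P_L := (pairField dWaveFormFactor L)ᴴ(pairField
dWaveFormFactor L) (= 2Δ_d†Δ_d); seeded Hamiltonians H_L(U,g) := hubbardTorus 2 L 1 U − (g/L²)P_L
(canonical) and hubbardTorusWith 2 L 1 U μ − (g/L²)P_L (grand-canonical); V := szSector N 0; e(g) :=
minEnergyOn(H_L(U,g), V)/L²; p_L(β,μ,U,g) := log Z/(βL²) of the GC seeded model
(Matrix.partitionFn); p̃_L(β,μ,U,h) := the same for dWaveSourceTorus L U μ h = hubbardTorusWith −
h(pairField + pairFieldᴴ) (linear, U(1)-breaking pair SOURCE, h real; p̃ is even in h by a gauge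
rotation). CLAIM: for δ ∈ [1/10,2/5] there are U₀,K>0 (K·U₀ ≤ 1/20) such that for 0<U≤U₀ and every g
∈ [K·U, 1/10] some c(U,g)>0 bounds ⟨ψ,P_Lψ⟩ ≥ cL⁴ for EVERY normalised (N_L,S^z=0)-sector ground
state ψ of H_L(U,g), eventually in even L. It closes by TwRungGlue from TwSectorEnergyLowerBound +
TwApproximatingHamiltonian (known) + TwSourcedInertness + TwSourcedCondensation +
TwSeededEnsembleEquivalence: chord ⟨P_L⟩_ψ ≥ L⁴(e(g')−e(g))/(g−g') with g' = U/(C(a+U₀)) inert,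
e(g') ≥ μ₁n − p_L(g') ≥ μ₁n − p̃_L(0) − ε (AHM hard hal -/
@[route_item "route-HubbardSuperconductivity-ThermalWedge"]
def TwSeededRung : Prop :=
  ∀ δ ∈ Set.Icc (1/10 : ℝ) (2/5 : ℝ), ∃ U₀ K : ℝ, 0 < U₀ ∧ 0 < K ∧ K * U₀ ≤ 1 / 20 ∧ ∀ U ∈ Set.Ioc (0 : ℝ) U₀, (∀ g ∈ Set.Icc (K * U) (1 / 10), ∃ c : ℝ, 0 < c ∧ ∃ L₀ : ℕ, ∀ (L : ℕ) [NeZero L], L₀ ≤ L → Even L → ∀ (ψ : Literature.MathematicalPhysics.QuantumLattice.Fock (Literature.MathematicalPhysics.QuantumLattice.Orb (Literature.MathematicalPhysics.QuantumLattice.FermionTorus 2 L))), star ψ ⬝ᵥ ψ = 1 → Literature.MathematicalPhysics.QuantumLattice.IsGroundStateInSector (Literature.MathematicalPhysics.QuantumLattice.hubbardTorus 2 L 1 U - ((g / (L : ℝ) ^ 2 : ℝ) : ℂ) • ((Literature.MathematicalPhysics.QuantumLattice.pairField Literature.MathematicalPhysics.QuantumLattice.dWaveFormFactor L)ᴴ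 * Literature.MathematicalPhysics.QuantumLattice.pairField Literature.MathematicalPhysics.QuantumLattice.dWaveFormFactor L)) (2 * ⌊(1 - δ) * (L : ℝ) ^ 2 / 2⌋₊) 0 ψ → c * (L : ℝ) ^ 4 ≤ (Literature.MathematicalPhysics.QuantumLattice.expect ((Literature.MathematicalPhysics.QuantumLattice.pairField Literature.MathematicalPhysics.QuantumLattice.dWaveFormFactor L)ᴴ * Literature.MathematicalPhysics.QuantumLattice.pairField Literature.MathematicalPhysics.QuantumLattice.dWaveFormFactor L) ψ).re)

/-- item stmt-HubbardSuperconductivity-1701 · support · rank 9 · closed · proved by Summit.HubbardSuperconductivity.HubbardSuperconductivity.Theorems.twSectorEnergyLowerBound_proof (prover) · by planner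
sources: Griffiths1966, Ruelle1969
[support, provable now] THERMODYNAMIC LOWER BOUND ON THE SECTOR GROUND-STATE ENERGY (trivial half of
the one-point Legendre inequality). NOTATION (all items): P_L := (pairField dWaveFormFactor
L)ᴴ(pairField dWaveFormFactor L) (= 2Δ_d†Δ_d); seeded Hamiltonians H_L(U,g) := hubbardTorus 2 L 1 U
− (g/L²)P_L (canonical) and hubbardTorusWith 2 L 1 U μ − (g/L²)P_L (grand-canonical); V := szSector
N 0; e(g) := minEnergyOn(H_L(U,g), V)/L²; p_L(β,μ,U,g) := log Z/(βL²) of the GC seeded model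
(Matrix.partitionFn); p̃_L(β,μ,U,h) := the same for dWaveSourceTorus L U μ h = hubbardTorusWith −
h(pairField + pairFieldᴴ) (linear, U(1)-breaking pair SOURCE, h real; p̃ is even in h by a gauge
rotation). CLAIM: for every L, N, U, μ, β>0, g with V = szSector N 0 ≠ ⊥: μN/L² − p_L(β,μ,U,g) ≤
e(g). PROOF (10 lines of real analysis + tree facts): Z = Tr e^{−β(H_g − μN̂)} = Σ_i e^{−βλ_i}
(Matrix.partitionFn_eq_sum_exp) ≥ e^{−β⟨ψ,(H_g−μN̂)ψ⟩} for every unit vector ψ (Jensen in the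
eigenbasis); for ψ ∈ V, ⟨ψ,N̂ψ⟩ = N (IsNParticle), so ⟨ψ,H_gψ⟩ ≥ μN − (log Z)/β; take the infimum
over unit ψ ∈ V (Matrix.minEnergyOn is that sInf) and divide by L². hubbardTorusWith − (g/L²)P = H_g
− μ·totalNumber by hubbardTorusWit -/
@[route_item "route-HubbardSuperconductivity-ThermalWedge"]
def TwSectorEnergyLowerBound : Prop :=
  ∀ (L : ℕ) [NeZero L] (N : ℕ) (U μ β g : ℝ), 0 < β → (Literature.MathematicalPhysics.QuantumLattice.szSector (Λ := Literature.MathematicalPhysics.QuantumLattice.FermionTorus 2 L) N 0) ≠ ⊥ → μ * (N : ℝ) / (L : ℝ) ^ 2 - (Real.log (Matrix.partitionFn β (Literature.MathematicalPhysics.QuantumLattice.hubbardTorusWith 2 L 1 U μ - ((g / (L : ℝ) ^ 2 : ℝ) : ℂ) • ((Literature.MathematicalPhysics.QuantumLattice.pairField Literature.MathematicalPhysics.QuantumLattice.dWaveFormFactor L)ᴴ * Literature.MathematicalPhysics.QuantumLattice.pairField Literature.MathematicalPhysics.QuantumLattice.dWaveFormFactor L))).re / (β * (L : ℝ) ^ 2))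 ≤ (((Literature.MathematicalPhysics.QuantumLattice.hubbardTorus 2 L 1 U - ((g / (L : ℝ) ^ 2 : ℝ) : ℂ) • ((Literature.MathematicalPhysics.QuantumLattice.pairField Literature.MathematicalPhysics.QuantumLattice.dWaveFormFactor L)ᴴ * Literature.MathematicalPhysics.QuantumLattice.pairField Literature.MathematicalPhysics.QuantumLattice.dWaveFormFactor L))).minEnergyOn (Literature.MathematicalPhysics.QuantumLattice.szSector (Λ := Literature.MathematicalPhysics.QuantumLattice.FermionTorus 2 L) N 0) / (L : ℝ) ^ 2)

/-- item stmt-HubbardSuperconductivity-1702 · support · rank 9 · closed · proved by Summit.HubbardSuperconductivity.HubbardSuperconductivity.Theorems.twPureThermalBound_proof @ 353c61e6a0ae (prover) · by planner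
sources: Ruelle1969, LiebSeiringerSolovejYngvason2005, Griffiths1966
[support, standard] PURE-MODEL ENSEMBLE EQUIVALENCE + ENTROPY PRICE, μ LOCALISED. NOTATION (all
items): P_L := (pairField dWaveFormFactor L)ᴴ(pairField dWaveFormFactor L) (= 2Δ_d†Δ_d); seeded
Hamiltonians H_L(U,g) := hubbardTorus 2 L 1 U − (g/L²)P_L (canonical) and hubbardTorusWith 2 L 1 U μ
− (g/L²)P_L (grand-canonical); V := szSector N 0; e(g) := minEnergyOn(H_L(U,g), V)/L²; p_L(β,μ,U,g)
:= log Z/(βL²) of the GC seeded model (Matrix.partitionFn); p̃_L(β,μ,U,h) := the same for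
dWaveSourceTorus L U μ h = hubbardTorusWith − h(pairField + pairFieldᴴ) (linear, U(1)-breaking pair
SOURCE, h real; p̃ is even in h by a gauge rotation). CLAIM: for δ ∈ [1/10,2/5] there are −4<μ₁≤μ₂<0
and U₀ such that for 0<U≤U₀, β≥1 some μ ∈ [μ₁,μ₂] has e(0) + p_L(β,μ,U,0) − μN_L/L² ≤ ln4/β + ε
eventually in L. PROOF SKETCH: (i) e(0) ≤ f^V_L(β) + (βL²)⁻¹log dim V, dim V ≤ 4^{L²}; (ii) f^V_L(β)
→ f_can(β,1−δ,U) = sup_μ[μ(1−δ) − p(β,μ,U)] (equivalence of ensembles for finite-range lattice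
fermions, Ruelle1969 Ch.3 / Lima; the S^z=0 restriction costs log(N+1)/L² because every SU(2)
multiplet meets S^z=0), sup attained at μ* since p is convex and coercive; (iii) μ* ∈ [μ₁,μ₂]: from
U·n↑n↓ ≥ 0 and n↑n↓ ≤ (n↑+n↓)/ -/
@[route_item "route-HubbardSuperconductivity-ThermalWedge", crux]
def TwPureThermalBound : Prop :=
  ∀ δ ∈ Set.Icc (1/10 : ℝ) (2/5 : ℝ), ∃ μ₁ μ₂ : ℝ, -4 < μ₁ ∧ μ₁ ≤ μ₂ ∧ μ₂ < 0 ∧ ∃ U₀ : ℝ, 0 < U₀ ∧ ∀ U ∈ Set.Ioc (0 : ℝ) U₀, ∀ β : ℝ, 1 ≤ β → ∃ μ ∈ Set.Icc μ₁ μ₂, ∀ ε : ℝ, 0 < ε → ∃ L₀ : ℕ, ∀ (L : ℕ) [NeZero L], L₀ ≤ L → ((Literature.MathematicalPhysics.QuantumLattice.hubbardTorus 2 L 1 U).minEnergyOn (Literature.MathematicalPhysics.QuantumLattice.szSector (Λ := Literature.MathematicalPhysics.QuantumLattice.FermionTorus 2 L) (2 * ⌊(1 - δ) * (L : ℝ)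 ^ 2 / 2⌋₊) 0) / (L : ℝ) ^ 2) + (Real.log (Matrix.partitionFn β (Literature.MathematicalPhysics.QuantumLattice.hubbardTorusWith 2 L 1 U μ)).re / (β * (L : ℝ) ^ 2)) - μ * ((2 * ⌊(1 - δ) * (L : ℝ) ^ 2 / 2⌋₊) : ℝ) / (L : ℝ) ^ 2 ≤ Real.log 4 / β + ε

/-- item stmt-HubbardSuperconductivity-1703 · support · rank 9 · closed · proved by Summit.HubbardSuperconductivity.HubbardSuperconductivity.Theorems.twApproximatingHamiltonian_proof (prover) · by planner
sources: BogolyubovJrEtAl1984, Bogolubov1966, BruPedra2013, BruDesiqueiraAlves2024, BruPedra2010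
[support, KNOWN THEOREM — port] APPROXIMATING-HAMILTONIAN THEOREM FOR THE d-WAVE-SEEDED HUBBARD
TORUS AT T>0 (card item (3)). NOTATION (all items): P_L := (pairField dWaveFormFactor L)ᴴ(pairField
dWaveFormFactor L) (= 2Δ_d†Δ_d); seeded Hamiltonians H_L(U,g) := hubbardTorus 2 L 1 U − (g/L²)P_L
(canonical) and hubbardTorusWith 2 L 1 U μ − (g/L²)P_L (grand-canonical); V := szSector N 0; e(g) :=
minEnergyOn(H_L(U,g), V)/L²; p_L(β,μ,U,g) := log Z/(βL²) of the GC seeded model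
(Matrix.partitionFn); p̃_L(β,μ,U,h) := the same for dWaveSourceTorus L U μ h = hubbardTorusWith −
h(pairField + pairFieldᴴ) (linear, U(1)-breaking pair SOURCE, h real; p̃ is even in h by a gauge
rotation). CLAIM for β>0, g>0: (easy half, every L) p̃_L(β,μ,U,h) − h²/g ≤ p_L(β,μ,U,g) for all real
h — from the operator inequality −(g/L²)ΔᴴΔ ≤ −h(Δ+Δᴴ) + (h²L²/g)·1 (expand (Δ − hL²/g)ᴴ(Δ − hL²/g)
≥ 0, Δ = pairField) and monotonicity of log Tr e^{−β·}; (hard half) ∀ε ∃L₀ ∀L≥L₀ ∃h: p_L(g) ≤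
p̃_L(h) − h²/g + ε. The hard half is Theorem (ii) of Bogolyubov
Jr.–Brankov–Zagrebnov–Kurbatov–Tonchev (BogolyubovJrEtAl1984; restated as Thm 'AHM' in BruPedra2013
§10.2 with conditions (A1)–(A3): finite pressure of T, ‖𝒰‖ ≤ C₁|Λ|, ‖[𝒰 -/
@[route_item "route-HubbardSuperconductivity-ThermalWedge"]
def TwApproximatingHamiltonian : Prop :=
  ∀ (U μ β g : ℝ), 0 < β → 0 < g → (∀ (L : ℕ) [NeZero L] (h : ℝ), (Real.log (Matrix.partitionFn β (Literature.MathematicalPhysics.QuantumLattice.dWaveSourceTorus L U μ h)).re / (β * (L : ℝ) ^ 2)) - h ^ 2 / g ≤ (Real.log (Matrix.partitionFn β (Literature.MathematicalPhysics.QuantumLattice.hubbardTorusWith 2 L 1 U μ - ((g / (L : ℝ) ^ 2 : ℝ) : ℂ) • ((Literature.MathematicalPhysics.QuantumLattice.pairField Literature.MathematicalPhysics.QuantumLattice.dWaveFormFactor L)ᴴ * Literature.MathematicalPhysics.QuantumLattice.pairField Literature.MathematicalPhysics.QuantumLattice.dWaveFormFactor L))).re / (β * (L : ℝ) ^ 2)))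 ∧ (∀ ε : ℝ, 0 < ε → ∃ L₀ : ℕ, ∀ (L : ℕ) [NeZero L], L₀ ≤ L → ∃ h : ℝ, (Real.log (Matrix.partitionFn β (Literature.MathematicalPhysics.QuantumLattice.hubbardTorusWith 2 L 1 U μ - ((g / (L : ℝ) ^ 2 : ℝ) : ℂ) • ((Literature.MathematicalPhysics.QuantumLattice.pairField Literature.MathematicalPhysics.QuantumLattice.dWaveFormFactor L)ᴴ * Literature.MathematicalPhysics.QuantumLattice.pairField Literature.MathematicalPhysics.QuantumLattice.dWaveFormFactor L))).re / (β * (L : ℝ) ^ 2)) ≤ (Real.log (Matrix.partitionFn β (Literature.MathematicalPhysics.QuantumLattice.dWaveSourceTorus L U μ h)).re / (β * (L : ℝ) ^ 2)) - h ^ 2 / g + ε)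

/-- item stmt-HubbardSuperconductivity-1704 · support · rank 9 · open · by planner
sources: BenfattoGiulianiMastropietro2006, KomaTasaki1994, DysonLiebSimon1978, idea:HubbardSuperconductivity/HubbardSuperconductivity/thermal-wedge-entropy-sandwich, idea:HubbardSuperconductivity/HubbardSuperconductivity/probe-legendre-order-ceiling
[support, target-type — THE CALIBRATION PAYOFF (card item (A))] EXPONENTIAL CEILING ON THE PURE
MODEL'S EVERY-GROUND-STATE d-WAVE ORDER AT WEAK COUPLING. NOTATION (all items): P_L := (pairField
dWaveFormFactor L)ᴴ(pairField dWaveFormFactor L) (= 2Δ_d†Δ_d); seeded Hamiltonians H_L(U,g) :=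
hubbardTorus 2 L 1 U − (g/L²)P_L (canonical) and hubbardTorusWith 2 L 1 U μ − (g/L²)P_L
(grand-canonical); V := szSector N 0; e(g) := minEnergyOn(H_L(U,g), V)/L²; p_L(β,μ,U,g) := log
Z/(βL²) of the GC seeded model (Matrix.partitionFn); p̃_L(β,μ,U,h) := the same for dWaveSourceTorus
L U μ h = hubbardTorusWith − h(pairField + pairFieldᴴ) (linear, U(1)-breaking pair SOURCE, h real;
p̃ is even in h by a gauge rotation). CLAIM: for δ ∈ [1/10,2/5] there are U₀,a,C>0 such that for
0<U≤U₀, eventually in L, EVERY normalised (N_L,S^z=0)-sector ground state ψ of hubbardTorus 2 L 1 U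
has ⟨ψ,P_Lψ⟩/L⁴ ≤ C e^{−a/U}/U. Closes by TwCeilingGlue from TwSectorEnergyLowerBound +
TwPureThermalBound + TwApproximatingHamiltonian + TwSourcedInertness (chain: g₁⟨P_L⟩_ψ ≤
L⁴(e(0)−e(g₁)) ≤ L⁴[p_L(g₁) − p_L(0) + ln4/β + ε] ≤ L⁴[p̃_L(h_L) − h_L²/g₁ − p̃_L(0) + ln4/β + 2ε] ≤
L⁴[ln4/β + 2ε] with β = e^{a/U}, g₁ = U/(C(a+U₀)) iner -/
@[route_item "route-HubbardSuperconductivity-ThermalWedge"]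
def TwExponentialCeiling : Prop :=
  ∀ δ ∈ Set.Icc (1/10 : ℝ) (2/5 : ℝ), ∃ U₀ a C : ℝ, 0 < U₀ ∧ 0 < a ∧ 0 < C ∧ ∀ U ∈ Set.Ioc (0 : ℝ) U₀, ∃ L₀ : ℕ, ∀ (L : ℕ) [NeZero L], L₀ ≤ L → ∀ (ψ : Literature.MathematicalPhysics.QuantumLattice.Fock (Literature.MathematicalPhysics.QuantumLattice.Orb (Literature.MathematicalPhysics.QuantumLattice.FermionTorus 2 L))), star ψ ⬝ᵥ ψ = 1 → Literature.MathematicalPhysics.QuantumLattice.IsGroundStateInSector (Literature.MathematicalPhysics.QuantumLattice.hubbardTorus 2 L 1 U) (2 * ⌊(1 - δ) * (L : ℝ) ^ 2 / 2⌋₊) 0 ψ → (Literature.MathematicalPhysics.QuantumLattice.expect ((Literature.MathematicalPhysics.QuantumLattice.pairField Literature.MathematicalPhysics.QuantumLattice.dWaveFormFactor L)ᴴ * Literature.MathematicalPhysics.QuantumLattice.pairField Literature.MathematicalPhysics.QuantumLattice.dWaveFormFactor L) ψ).re / (L : ℝ) ^ 4 ≤ C * Real.exp (-a / U) / U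

/-- item stmt-HubbardSuperconductivity-1705 · support · rank 9 · closed · proved by Summit.HubbardSuperconductivity.HubbardSuperconductivity.Theorems.twCeilingGlue_proof @ 18eead5ce963 (prover) · by planner
sources: idea:HubbardSuperconductivity/HubbardSuperconductivity/thermal-wedge-entropy-sandwich
[support, provable now — GLUE] TwSectorEnergyLowerBound → TwPureThermalBound →
TwApproximatingHamiltonian → TwSourcedInertness → TwExponentialCeiling. Pure bookkeeping over the
reals plus one finite-dimensional fact: for a normalised GS ψ of H (g=0) in V, minEnergyOn(H_{g₁},V)
≤ Re⟨ψ,H_{g₁}ψ⟩ (csInf_le; the Rayleigh set is bounded below in finite dimension) so g₁⟨ψ,P_Lψ⟩ ≤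
L⁴(e(0) − e(g₁)); V ≠ ⊥ because ψ ∈ V is a unit vector. Constants: given δ take (μ₁,μ₂,U₀') from
TwPureThermalBound, (U₀,a,C) from TwSourcedInertness for [μ₁,μ₂], β := e^{a/U} (≥1), g₁ :=
U/(C(a+U₀)) so that C(1+log β)·g₁ ≤ 1 (inertness ⇒ p̃_L(h) − h²/g₁ ≤ p̃_L(0)), ε := e^{−a/U};
p_L(β,μ,U,0) and p̃_L(β,μ,U,0) agree by dWaveSourceTorus_zero / sub_zero. Output constant C' =
C(a+U₀)(ln4+3). ~150 lines. -/
@[route_item "route-HubbardSuperconductivity-ThermalWedge"]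
def TwCeilingGlue : Prop :=
  TwSectorEnergyLowerBound → TwPureThermalBound → TwApproximatingHamiltonian → TwSourcedInertness → TwExponentialCeiling

/-- item stmt-HubbardSuperconductivity-1706 · support · rank 9 · closed · proved by Summit.HubbardSuperconductivity.HubbardSuperconductivity.Theorems.twRungGlue_proof (prover) · by planner
sources: idea:HubbardSuperconductivity/HubbardSuperconductivity/thermal-wedge-entropy-sandwich
[support, provable now — GLUE] TwSectorEnergyLowerBound → TwApproximatingHamiltonian →
TwSourcedInertness → TwSourcedCondensation → TwSeededEnsembleEquivalence → TwSeededRung. Bookkeeping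
+ the rung chord: for a normalised GS ψ of H_L(U,g) in V and g' < g, minEnergyOn(H_{g'},V) ≤
Re⟨ψ,H_{g'}ψ⟩ = L²e(g) + ((g−g')/L²)⟨ψ,P_Lψ⟩, so ⟨ψ,P_Lψ⟩ ≥ L⁴(e(g')−e(g))/(g−g'). Constants (worked
out in the planner's NOTES): given δ take (μ₁,μ₂,U₀^e) from TwSeededEnsembleEquivalence, (U₀ⁱ,aⁱ,C)
and (U₀ᶜ,aᶜ,c,C_c,h₀) from the two sourced cruxes for [μ₁,μ₂]; a := min(aⁱ,aᶜ), β := e^{a/U},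
auxiliary inert seed g' := U/(C(a+U₀)), θ := 1/4, h := e^{−θa/U} (≤ h₀ for small U), K :=
max(2/(cθa), 2/(C(a+U₀))) so that K·U > g' and 1/(KU) ≤ cθa/(2U), U₀ := min of all thresholds incl.
cθa/(4(c ln2 + C_c)) and 1/(20K); then e(g')−e(g) ≥ e^{−a/(2U)}·cθa/(4U) − ln4·e^{−a/U} − 2ε > 0
with ε := e^{−a/U}, giving c(U,g) := (that margin)·10 > 0 for all g ∈ [K·U,1/10], L ≥ max of the
five L₀'s (Even L unused). ~250 lines. -/
@[route_item "route-HubbardSuperconductivity-ThermalWedge"]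
def TwRungGlue : Prop :=
  TwSectorEnergyLowerBound → TwApproximatingHamiltonian → TwSourcedInertness → TwSourcedCondensation → TwSeededEnsembleEquivalence → TwSeededRung

-- earlier Assembly (stmt-HubbardSuperconductivity-1707, replaced 2026-08-15T22:48:57Z -> stmt-HubbardSuperconductivity-13891): proved by Summit.HubbardSuperconductivity.HubbardSuperconductivity.Theorems.Assembly_proof @ a6a1673b541f — TwSeededRung → TwTipContinuation → HubbardSuperconductivity
/-- item stmt-HubbardSuperconductivity-13891 · assembly · rank 1 · closed · proved by Summit.HubbardSuperconductivity.HubbardSuperconductivity.Theorems.thermalWedge_assembly_structural (prover) · by planner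
sources: Scalapino1995, idea:HubbardSuperconductivity/HubbardSuperconductivity/thermal-wedge-entropy-sandwich
[assembly] X → S with X = the thesis conjunction: `TwSeededRung ∧ TwTipContinuation →
HubbardSuperconductivity` (rev 2, route-repair 2026-08-15; = the rev-1 item
stmt-HubbardSuperconductivity-1707 `TwSeededRung → TwTipContinuation → HubbardSuperconductivity`
uncurried). BOOKKEEPING ONLY — it is proved in this very file by the deciding theorem `closes` (`fun
h => closes h.1 h.2`, planner Sketch.lean rc0); provers attack the cruxes. PROVERS / GROUNDERS /
REFUTERS: do NOT close this item with a theorem whose module imports …Theses.ThermalWedge — the gate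
links `Assembly_holds := _root_.<thm>` by importing that module INTO THIS FILE, and a module
importing this file cycles (route unmaterialisable, `closes` unauditable). That is exactly what the
rev-1 proof Theorems/ThermalWedgeAssembly.lean (`Assembly_proof`, closing stmt-1707) did; stmt-1707
is therefore DETACHED (stays proved on the ledger) and, after this restatement, that module no
longer elaborates (its statement is the old curried body): port it — a lean-checked,
import-cycle-free STRUCTURAL candidate `thermalWedge_assembly_structural` (verbatim bodies of
TwSeededRung/TwTipContinuation, imports Summits.HubbardSuperconductivity.St -/
@[route_item "route-HubbardSuperconductivity-ThermalWedge"]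
def Assembly : Prop :=
  TwSeededRung ∧ TwTipContinuation → _root_.HubbardSuperconductivity

/-- `Assembly` holds: proved by `Summit.HubbardSuperconductivity.HubbardSuperconductivity.Theorems.thermalWedge_assembly_structural`. -/
theorem Assembly_holds : Assembly := _root_.Summit.HubbardSuperconductivity.HubbardSuperconductivity.Theorems.thermalWedge_assembly_structural

/-! D-0027 §2.1 — DECIDING THEOREM (planner-authored via `route open/edit --closes-file`; by planner-rrepair-HubbardSuperconductivity-Therm-aae78db9-0 2026-08-16T15:39:14Z):
its hypotheses are this route's items and its conclusion the sub-problem Statement (glue_lint), and it elaborates with this file. -/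

@[closes "route-HubbardSuperconductivity-ThermalWedge"] theorem closes (hC : TwSourcedCondensation) (hE : TwSeededEnsembleEquivalenceR)
    (hG : TwThermalWindowRungGlue) (hT : TwTipContinuation) : _root_.HubbardSuperconductivity := by
  -- the anchor (support item `TwSeededRung`) is discharged by the binder item
  -- `TwThermalWindowRungGlue : TwSeededEnsembleEquivalenceR → TwSourcedCondensation → TwSeededRung`
  -- (= the landed engine Theorems.twSeededRung_structural_thermalWindow, p97295, restated over route
  -- decls; filed as an ITEM so that this file does not import the engine module, whose transitive
  -- imports drag three unproved named Literature facts into the route's import cone)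
  have hR : TwSeededRung := hG hE hC
  -- tip: pure logic (U := min U₀ U₁, δ from the tip, K·U ≤ K·U₀ ≤ 1/20, [1/10,2/5] ⊂ (0,1/2))
  obtain ⟨U₁, hU₁, δ, hδ, hTip⟩ := hT
  obtain ⟨U₀, K, hU₀, hK, hKU₀, hRung⟩ := hR δ hδ
  have hUpos : 0 < min U₀ U₁ := lt_min hU₀ hU₁
  have hU₀mem : min U₀ U₁ ∈ Set.Ioc (0 : ℝ) U₀ := ⟨hUpos, min_le_left _ _⟩
  have hU₁mem : min U₀ U₁ ∈ Set.Ioc (0 : ℝ) U₁ := ⟨hUpos, min_le_right _ _⟩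
  have hKU : K * min U₀ U₁ ≤ 1 / 20 :=
    le_trans (mul_le_mul_of_nonneg_left (min_le_left _ _) hK.le) hKU₀
  have hδ' : δ ∈ Set.Ioo (0 : ℝ) (1 / 2) := by
    obtain ⟨h₁, h₂⟩ := hδ
    constructor <;> linarith
  exact ⟨min U₀ U₁, hUpos, δ, hδ', fun N ψ hyp =>
    hTip (min U₀ U₁) hU₁mem K hK hKU (hRung (min U₀ U₁) hU₀mem) N ψ hyp⟩

end Summit.HubbardSuperconductivity.HubbardSuperconductivity.Theses.ThermalWedge
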